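import Mathlib
import HarnessLib

/-!
# Crux `Steer` (stmt-ResolutionOfSingularities-16345) — K-TX part 4d, the exponent-row / dual-weight BOOKKEEPING of the unit letters:
# log-pairings `⟨c, k⟩ = Σ_v k_v·c_v`, Kronecker duality, and its persistence under division steps and tie-births

Folklore linear algebra (design: seat folder `D/res-D-brk-2/HANDOFF.md`, gen 6, "4d route REFINED").

Along the toric tower every UNIT letter `z_j` (`j ∈ U`) is sent by the transport map `Φ` to (a constant times) a Laurent monomial
`Y^{k_j}`, `k_j : ι →₀ ℤ`; we carry DUAL WEIGHTS `c_j : ι → κ` with `⟨c_j, k_{j'}⟩ = δ_{jj'}` (`DualRows`).  A division step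
`z_b ↦ z_b / z_a` between unit letters replaces `k_b` by `k_b − k_a` and is compensated by `c_a ↦ c_a + c_b` (`DualRows.div_step`); a
tie-birth gives the new unit letter `b` a FRESH variable `v` (`k_b = single v 1`, `c_b = ` indicator of `v`; `DualRows.birth`); letters
leaving nothing change nothing (`DualRows.mono`).  At the end `⟨c_u, k_u⟩ = 1` for the survivor `u` (`DualRows.self`), which is the
non-vanishing the Euler end argument `…ToricUnitExitEuler.sq_free_euler` consumes (in characteristic `2`, where `⟨c, k⁺ + k⁻⟩ = ⟨c, k⁺ − k⁻⟩`,
`logPair_add_eq_sub_of_two_eq_zero`).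

Contents (namespace `…Theorems.SteerToricUnitExit`): `logPair`, `logPair_add`, `logPair_neg`, `logPair_sub`, `logPair_single`,
`logPair_add_left`, `logPair_toFinsupp_natCast`, `logPair_add_eq_sub_of_two_eq_zero`, `DualRows`, `DualRows.self`, `DualRows.mono`,
`DualRows.div_step`, `DualRows.birth`.
-/

-- single-problem summit: the doubled namespace component `ResolutionOfSingularities` is forced
set_option linter.dupNamespace false

open scoped BigOperators

noncomputable section

namespace Summit.ResolutionOfSingularities.ResolutionOfSingularities.Theorems.SteerToricUnitExit

variable {ι κ : Type*} [CommRing κ]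

/-- The log-pairing `⟨c, k⟩ = Σ_v k_v · c_v` of weights `c` with an integer exponent row `k`. [folklore] -/
def logPair (c : ι → κ) (k : ι →₀ ℤ) : κ := k.sum fun v n => (n : κ) * c v

/-- Additivity in the row. [folklore] -/
theorem logPair_add (c : ι → κ) (k k' : ι →₀ ℤ) : logPair c (k + k') = logPair c k + logPair c k' := by
  unfold logPair
  exact Finsupp.sum_add_index' (fun _ => by simp) (fun _ _ _ => by push_cast; ring)

/-- Negation in the row. [folklore] -/
theorem logPair_neg (c : ι → κ) (k : ι →₀ ℤ) : logPair c (-k) = -logPair c k := by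
  have h := logPair_add c k (-k)
  rw [add_neg_cancel] at h
  have h0 : logPair c 0 = 0 := by simp [logPair]
  rw [h0] at h
  linear_combination -h

/-- Subtraction in the row. [folklore] -/
theorem logPair_sub (c : ι → κ) (k k' : ι →₀ ℤ) : logPair c (k - k') = logPair c k - logPair c k' := by
  rw [sub_eq_add_neg, logPair_add, logPair_neg, ← sub_eq_add_neg]

/-- The pairing with a single row. [folklore] -/
theorem logPair_single (c : ι → κ) (v : ι) (n : ℤ) : logPair c (Finsupp.single v n) = (n : κ) * c v := by
  unfold logPair
  exact Finsupp.sum_single_index (by simp)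

/-- Additivity in the weights. [folklore] -/
theorem logPair_add_left (c c' : ι → κ) (k : ι →₀ ℤ) : logPair (c + c') k = logPair c k + logPair c' k := by
  unfold logPair
  simp only [Pi.add_apply, mul_add, Finsupp.sum_add]

/-- The pairing of a natural-number row, cast to `ℤ`, is the `ℕ`-sum `Σ_v k_v · c_v`. [folklore] -/
theorem logPair_mapRange_natCast (c : ι → κ) (k : ι →₀ ℕ) :
    logPair c (k.mapRange (fun n : ℕ => (n : ℤ)) (by simp)) = k.sum fun v n => (n : κ) * c v := by
  unfold logPair
  rw [Finsupp.sum_mapRange_index (fun _ => by simp)]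
  simp

/-- In characteristic `2`: `⟨c, k⁺ + k⁻⟩ = ⟨c, k⁺ − k⁻⟩`. [folklore] -/
theorem logPair_add_eq_sub_of_two_eq_zero (h2 : (2 : κ) = 0) (c : ι → κ) (k k' : ι →₀ ℤ) :
    logPair c (k + k') = logPair c (k - k') := by
  rw [logPair_add, logPair_sub, sub_eq_add_neg]
  congr 1
  have : (2 : κ) * logPair c k' = 0 := by rw [h2, zero_mul]
  linear_combination this

/-- **Dual rows.** On the index set `U` (the current unit letters) the weights `c_j` and rows `k_j` are Kronecker dual. [folklore] -/
def DualRows {J : Type*} [DecidableEq J] (U : Set J) (k : J → ι →₀ ℤ) (c : J → ι → κ) : Prop :=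
  ∀ j ∈ U, ∀ j' ∈ U, logPair (c j) (k j') = if j = j' then 1 else 0

namespace DualRows

variable {J : Type*} [DecidableEq J] {U : Set J} {k : J → ι →₀ ℤ} {c : J → ι → κ}

/-- The diagonal: `⟨c_j, k_j⟩ = 1`. [folklore] -/
theorem self (h : DualRows U k c) {j : J} (hj : j ∈ U) : logPair (c j) (k j) = 1 := by
  have := h j hj j hj; rwa [if_pos rfl] at this

/-- Restriction to a smaller index set. [folklore] -/
theorem mono (h : DualRows U k c) {U' : Set J} (hU : U' ⊆ U) : DualRows U' k c :=
  fun j hj j' hj' => h j (hU hj) j' (hU hj')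

/-- **Division step** `z_b ↦ z_b / z_a` (`a ≠ b` unit letters): rows `k_b ↦ k_b − k_a`, weights `c_a ↦ c_a + c_b`. [folklore] -/
theorem div_step (h : DualRows U k c) {a b : J} (ha : a ∈ U) (hb : b ∈ U) (hab : a ≠ b) :
    DualRows U (Function.update k b (k b - k a)) (Function.update c a (c a + c b)) := by
  intro j hj j' hj'
  have hδ := h j hj j' hj'
  by_cases hja : j = a
  · subst hja
    rw [Function.update_self]
    by_cases hj'b : j' = b
    · subst hj'b
      rw [Function.update_self, logPair_sub, logPair_add_left, logPair_add_left, h j hj j' hj', h j' hj' j' hj',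
        h j hj j hj, h j' hj' j hj, if_neg hab, if_pos rfl, if_pos rfl, if_neg (Ne.symm hab)]
      simp
    · rw [Function.update_of_ne hj'b, logPair_add_left, h j hj j' hj', h b hb j' hj', if_neg (Ne.symm hj'b)]
      simp
  · rw [Function.update_of_ne hja]
    by_cases hj'b : j' = b
    · subst hj'b
      rw [Function.update_self, logPair_sub, h j hj j' hj', h j hj a ha, if_neg hja]
      simp
    · rw [Function.update_of_ne hj'b]; exact hδ

/-- **Tie-birth**: a letter `b ∉ U` becomes a unit letter with a FRESH variable `v` (no current row or weight involves `v`): `k_b =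
single v 1`, `c_b = ` the indicator of `v`. [folklore] -/
theorem birth [DecidableEq ι] (h : DualRows U k c) {b : J} (hb : b ∉ U) (v : ι)
    (hkv : ∀ j ∈ U, k j v = 0) (hcv : ∀ j ∈ U, c j v = 0) :
    DualRows (insert b U) (Function.update k b (Finsupp.single v 1)) (Function.update c b (Pi.single v 1)) := by
  intro j hj j' hj'
  rcases Set.mem_insert_iff.mp hj with rfl | hjU
  · rw [Function.update_self]
    rcases Set.mem_insert_iff.mp hj' with rfl | hj'U
    · rw [Function.update_self, logPair_single, if_pos rfl]; simp
    · have hne : j ≠ j' := fun e => hb (e ▸ hj'U)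
      rw [Function.update_of_ne (Ne.symm hne), if_neg hne]
      unfold logPair
      rw [Finsupp.sum]
      refine Finset.sum_eq_zero fun w hw => ?_
      by_cases hwv : w = v
      · subst hwv; rw [hkv j' hj'U]; simp
      · rw [Pi.single_eq_of_ne hwv, mul_zero]
  · have hne : j ≠ b := fun e => hb (e ▸ hjU)
    rw [Function.update_of_ne hne]
    rcases Set.mem_insert_iff.mp hj' with rfl | hj'U
    · rw [Function.update_self, logPair_single, hcv j hjU, if_neg hne]; simp
    · have hne' : j' ≠ b := fun e => hb (e ▸ hj'U)
      rw [Function.update_of_ne hne']; exact h j hjU j' hj'U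

end DualRows

end Summit.ResolutionOfSingularities.ResolutionOfSingularities.Theorems.SteerToricUnitExit

end
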